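import Mathlib

/-!
# SoloInformedDestabTwoNoGo — arithmetic skeleton of the DESTAB-2 no-go (solo-informed s41)

Context (not formalised; HOME `work/s41/nogo-destab2.md` §§1–3).  For a curve `c` on the genus-2
Heegaard surface meeting the tunnel belt once, Theorem F1 gives `gcd(sf, ℓ) = 1` from primitivity,
while the framing law (F) of the complement `W_F` reads `sf = ℓ (2σN − ℓ)` (up to the sign
conventions, which do not affect divisibility or parity).  The lemmas below show that this forces
`ℓ = ±1` and `sf` odd — exactly the regime in which the Casson–Rokhlin parity of `S³_{1/sf}(3₁)`
obstructs — and that the resulting filling slope `ℓ² μ + sf λ` is primitive.  The last lemma records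
why the Akbulut–Kirby control curves `(sf, ℓ) = (−2, ±1)` have odd (hence non-zero) framing defect,
and `soloInformed_unit_case` is the parity step of the one-sided no-go (Lemma 3(b), case `p = ±1`).
-/

namespace Summit.SmoothPoincare4.SmoothPoincare4.Theorems

/-- The framing equation (F), `sf = ℓ (2σN − ℓ)`, makes `ℓ` divide `sf`. -/
theorem soloInformed_framingEq_dvd {sf ℓ σ N : ℤ}
    (h : sf = ℓ * (2 * σ * N - ℓ)) : ℓ ∣ sf := ⟨2 * σ * N - ℓ, h⟩

/-- Coprimality (from primitivity, Theorem F1) and (F) force `ℓ = ±1`. -/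
theorem soloInformed_ell_unit {sf ℓ σ N : ℤ} (hcop : Int.gcd sf ℓ = 1)
    (h : sf = ℓ * (2 * σ * N - ℓ)) : ℓ = 1 ∨ ℓ = -1 := by
  have hdvd : ℓ ∣ sf := soloInformed_framingEq_dvd h
  have hc : IsCoprime sf ℓ := Int.isCoprime_iff_gcd_eq_one.mpr hcop
  exact Int.isUnit_iff.mp (hc.isUnit_of_dvd' hdvd (dvd_refl ℓ))

/-- … and then `sf` is odd (so `μ(S³_{1/sf}(3₁)) = 1` by Casson's formula). -/
theorem soloInformed_sf_odd {sf ℓ σ N : ℤ} (hcop : Int.gcd sf ℓ = 1)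
    (h : sf = ℓ * (2 * σ * N - ℓ)) : Odd sf := by
  rcases soloInformed_ell_unit hcop h with hl | hl <;> subst hl
  · exact ⟨σ * N - 1, by rw [h]; ring⟩
  · exact ⟨-(σ * N) - 1, by rw [h]; ring⟩

/-- The arithmetic core of No-go A packaged. -/
theorem soloInformed_destabTwo_arith (sf ℓ σ N : ℤ) (hcop : Int.gcd sf ℓ = 1)
    (h : sf = ℓ * (2 * σ * N - ℓ)) : (ℓ = 1 ∨ ℓ = -1) ∧ Odd sf :=
  ⟨soloInformed_ell_unit hcop h, soloInformed_sf_odd hcop h⟩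

/-- The filling slope `ℓ² μ_K + sf λ_K` of Theorem F1(c) is primitive. -/
theorem soloInformed_meridian_coprime {sf ℓ : ℤ} (hcop : Int.gcd sf ℓ = 1) :
    Int.gcd (ℓ ^ 2) sf = 1 := by
  have hc : IsCoprime sf ℓ := Int.isCoprime_iff_gcd_eq_one.mpr hcop
  exact Int.isCoprime_iff_gcd_eq_one.mp hc.symm.pow_left

/-- Akbulut–Kirby control curves `(sf, ℓ) = (−2, ±1)`: the framing defect
`sf + ℓ² + 2σNℓ` is odd, hence never zero. -/
theorem soloInformed_AK_defect_ne_zero (σ N ℓ : ℤ) (hℓ : ℓ = 1 ∨ ℓ = -1) :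
    (-2 : ℤ) + ℓ ^ 2 + 2 * σ * N * ℓ ≠ 0 := by
  rcases hℓ with rfl | rfl
  · intro h
    have h2 : (2 : ℤ) * (σ * N) = 1 := by linear_combination h
    omega
  · intro h
    have h2 : (2 : ℤ) * (σ * N) = -1 := by linear_combination (-1 : ℤ) * h
    omega

/-- Parity step of Lemma 3(b), case `p = ±1`: if the meridian `p μ_Y + q λ_Y` has `pq` even
(Rokhlin form of `T_b`) then `p + q` is odd, so the homology sphere `S³_{∓1/|p+q|}(3₁)` has odd
Casson invariant. -/
theorem soloInformed_unit_case (p q : ℤ) (hp : p = 1 ∨ p = -1) (hpq : Even (p * q)) :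
    Odd (p + q) := by
  rcases hp with rfl | rfl
  · have hq : Even q := by simpa using hpq
    rcases hq with ⟨k, hk⟩
    exact ⟨k, by omega⟩
  · have hq : Even q := by simpa using hpq
    rcases hq with ⟨k, hk⟩
    exact ⟨k - 1, by omega⟩

end Summit.SmoothPoincare4.SmoothPoincare4.Theorems
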